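import Summits.BirchSwinnertonDyer.Rank1Residual.Supersingular.KuriharaTwistSymbolKurihara
import Summits.BirchSwinnertonDyer.Rank1Residual.Supersingular.KuriharaTwistSchemaOdd
import HarnessLib

/-!
# The plus symbol in CRT coordinates V: ODD-`p` twist records (`TwistRecord.consistentOdd`, `p ≥ 3`, `ν < p`
# in the predicate) — a consistent record with the true bins certifies `δ̃_n ≢ 0 (mod p)`; the `p = 3` twin
# of `TwistRecord.kuriharaNumber_ne_zero_of_consistent`, asked for by the X8 class lead (additive-p3 GEN 19 (d))

Cell `b2b-bsdres`, supersingular family, prover A = unit `b2b-bsdres-x10b` (gen 10).  Topic file; namespace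
`Summit.BirchSwinnertonDyer.Rank1Residual.Supersingular.KuriharaTwist`.  THEOREMS ONLY; no definition, no named
fact, nothing asserted about any curve, nothing booked; marks unchanged.

HONEST FRAMING (run/shared/lean/b2b/bsd-rank1-residual/, verbatim in every file): the goal of the
cell is to DELETE the COMBINATION-SHAPED residual classes of the Birch–Swinnerton-Dyer formula for
ALL analytic-rank `≤ 1` elliptic curves over `ℚ` — "full BSD formula for every rank `≤ 1` curve in
class `C`" assembled STRICTLY from published theorems — so that the rank-`≤ 1` remainder becomes
exactly the CONSTRUCTION-SHAPED classes, which are TYPED (missing-input `Prop`s), NOT attempted.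
This is not "finishing BSD".

## What this file proves

`TwistRecord.kuriharaNumber_ne_zero_of_consistentOdd` and `…_of_consistentOdd_of_isNewformOf`: the statements
of `KuriharaTwistSymbolKurihara.lean` Part V with the schema predicate `TwistRecord.consistentOdd`
(n1011-p09, `KuriharaTwistSchemaOdd.lean`: `3 ≤ p` and `#primes < p` inside the predicate) in place of
`consistent` (`5 ≤ p`); so `p = 3` records (`certL3_…`, `CertifiedOddL`) are consumed, and the hypothesis
`hνp` disappears.  Same proof: recheck ⟹ `p ∤ e_ν`; `hbins` ⟹ `e_ν = D·c_∞·Σ_a binom(m(a),ν)[a/n]⁺_f`;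
Part III identity ⟹ `\overline{e_ν} = D·c_∞·δ̃_n`.  The depth-`k` (`TwistRecordK`) twin is
`KuriharaTwistSymbolKuriharaK.lean`; the `ω(n) = #primes` discharge is `KuriharaTwistRecordOmega.lean`.

References: `KuriharaTwistSymbolKurihara.lean`; `KuriharaTwistSchemaOdd.lean` (n1011-p09); C.-H. Kim,
arXiv:2203.12159 §1.4 [Kim2022StructureSelmer]; INBOX 2026-08-21T13:13Z (additive-p3 GEN 19, ask (d)).
-/

namespace Summit.BirchSwinnertonDyer.Rank1Residual.Supersingular.KuriharaTwist

open Literature.NumberTheory.DiophantineGeometry.Dioph (ratModP)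
open Literature.NumberTheory.EllipticCurves Literature.NumberTheory.EllipticCurves.ModularForms
open CongruenceSubgroup Finset
open scoped MatrixGroups ModularForm
open Summit.BirchSwinnertonDyer.BirchSwinnertonDyer.Theorems (deltaParity_ratModP_sum
  deltaParity_ratModP_intCast_mul)

section RecordOdd

variable {N : ℕ} [NeZero N] (f : CuspForm (Gamma0 N) 2)

/-- **AN ODD-`p` CONSISTENT TWIST RECORD WITH THE TRUE BINS CERTIFIES `δ̃_n ≢ 0`** (`p ≥ 3`; the `p = 3`
records `certL3_…`).  Hypotheses as in `TwistRecord.kuriharaNumber_ne_zero_of_consistent` with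
`r.consistentOdd` for `r.consistent` (and no separate `ν < p`). [cite: Kim2022StructureSelmer, §1.4.3 (PDF p. 7)] -/
theorem TwistRecord.kuriharaNumber_ne_zero_of_consistentOdd (r : TwistRecord) (hc : r.consistentOdd = true)
    (hδ : 0 < r.deltaModP) [hp : Fact r.p.Prime] [NeZero r.n]
    (hsq : Squarefree r.n) (hν : r.n.primeFactors.card = r.primes.length)
    (A : ℕ → ℤ)
    (hhecke : ∀ ℓ ∈ r.n.primeFactors, ∀ x : ℚ, (A ℓ : ℚ) * ratPlusSymbol f x =
      ∑ j : Fin ℓ, ratPlusSymbol f ((x + ((j : ℕ) : ℚ)) / (ℓ : ℚ)) + ratPlusSymbol f ((ℓ : ℚ) * x))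
    (hA : ∀ ℓ ∈ r.n.primeFactors, ((A ℓ : ℤ) : ZMod (r.p ^ 1)) = 2)
    (hint : ∀ d : ℕ, d ∣ r.n → ∀ z : ℤ, ‖((ratPlusSymbol f ((z : ℚ) / (d : ℚ)) : ℚ) : ℚ_[r.p])‖ ≤ 1)
    (ψ : (ℓ : ℕ) → (ZMod ℓ)ˣ →* Multiplicative (ZMod (r.p ^ 1)))
    (hbins : ∀ j < r.p, ((r.bins.getD j 0 : ℤ) : ℚ) = (r.den : ℚ) * (r.components : ℚ) *
      ∑ a ∈ (Finset.univ : Finset (ZMod r.n)ˣ).filter (fun a =>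
        (∑ ℓ ∈ r.n.primeFactors.attach, Multiplicative.toAdd
          (ψ ℓ.1 (ZMod.unitsMap (Nat.dvd_of_mem_primeFactors ℓ.2) a))).val = j),
        ratPlusSymbol f ((((a : ZMod r.n).val : ℕ) : ℚ) / (r.n : ℚ))) :
    kuriharaNumber f (r.p ^ 1) r.n ψ ≠ 0 := by
  have hp1 : r.p ^ 1 = r.p := pow_one r.p
  -- unpack the recheck
  have hc' := hc
  simp only [TwistRecord.consistentOdd, Bool.and_eq_true, decide_eq_true_eq, beq_iff_eq, bne_iff_ne,
    ne_eq, Bool.or_eq_true] at hc'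
  have hrec : r.deltaRecomputed = r.deltaModP := hc'.2
  have hlen : r.bins.length = r.p := hc'.1.1.1.1.1.2
  have hνp : r.primes.length < r.p := hc'.1.1.1.1.1.1.1.2
  -- (1) `p ∤ e_ν`, from `deltaRecomputed = deltaModP ∈ (0, p)`
  have hM : ¬ (r.p : ℤ) ∣ r.moment r.primes.length := by
    intro hdvd
    apply Nat.ne_of_gt hδ
    have h0 : (r.moment r.primes.length % (r.p : ℤ)).toNat = 0 := by
      rw [Int.emod_eq_zero_of_dvd hdvd]; rfl
    rw [← hrec, TwistRecord.deltaRecomputed, h0]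
    simp
  -- (2) the moment as a rational number, through the bins hypothesis, fibrewise
  have hm_lt : ∀ a : (ZMod r.n)ˣ, (∑ ℓ ∈ r.n.primeFactors.attach, Multiplicative.toAdd
      (ψ ℓ.1 (ZMod.unitsMap (Nat.dvd_of_mem_primeFactors ℓ.2) a))).val < r.p := fun a => by
    have := ZMod.val_lt (∑ ℓ ∈ r.n.primeFactors.attach, Multiplicative.toAdd
      (ψ ℓ.1 (ZMod.unitsMap (Nat.dvd_of_mem_primeFactors ℓ.2) a)))
    exact lt_of_lt_of_eq this hp1
  have hmomQ : ((r.moment r.primes.length : ℤ) : ℚ) = (r.den : ℚ) * (r.components : ℚ) *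
      ∑ a : (ZMod r.n)ˣ, (((∑ ℓ ∈ r.n.primeFactors.attach, Multiplicative.toAdd
        (ψ ℓ.1 (ZMod.unitsMap (Nat.dvd_of_mem_primeFactors ℓ.2) a))).val.choose r.primes.length : ℕ) : ℚ) *
        ratPlusSymbol f ((((a : ZMod r.n).val : ℕ) : ℚ) / (r.n : ℚ)) := by
    rw [r.moment_eq_sum r.primes.length, hlen, Int.cast_sum]
    simp_rw [Int.cast_mul, Int.cast_natCast]
    rw [show ∑ j ∈ Finset.range r.p, ((j.choose r.primes.length : ℕ) : ℚ) * ((r.bins.getD j 0 : ℤ) : ℚ) =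
        ∑ j ∈ Finset.range r.p, (r.den : ℚ) * (r.components : ℚ) *
          ∑ a ∈ (Finset.univ : Finset (ZMod r.n)ˣ).filter (fun a =>
            (∑ ℓ ∈ r.n.primeFactors.attach, Multiplicative.toAdd
              (ψ ℓ.1 (ZMod.unitsMap (Nat.dvd_of_mem_primeFactors ℓ.2) a))).val = j),
            (((∑ ℓ ∈ r.n.primeFactors.attach, Multiplicative.toAdd
              (ψ ℓ.1 (ZMod.unitsMap (Nat.dvd_of_mem_primeFactors ℓ.2) a))).val.choose r.primes.length : ℕ) :
                ℚ) * ratPlusSymbol f ((((a : ZMod r.n).val : ℕ) : ℚ) / (r.n : ℚ)) from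
      Finset.sum_congr rfl fun j hj => by
        rw [hbins j (Finset.mem_range.1 hj), Finset.mul_sum, Finset.mul_sum, Finset.mul_sum]
        refine Finset.sum_congr rfl fun a ha => ?_
        rw [(Finset.mem_filter.1 ha).2]
        ring]
    rw [← Finset.mul_sum, Finset.sum_fiberwise_of_maps_to (fun a _ => Finset.mem_range.2 (hm_lt a))]
  -- (3) reduce modulo `p` (= `p^1`): `\overline{e_ν} = D·c_∞·δ̃_n`
  have hintn : ∀ a : (ZMod r.n)ˣ, ‖((ratPlusSymbol f ((((a : ZMod r.n).val : ℕ) : ℚ) / (r.n : ℚ)) : ℚ) :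
      ℚ_[r.p])‖ ≤ 1 := fun a => by
    have := hint r.n (dvd_refl r.n) ((a : ZMod r.n).val : ℤ)
    push_cast at this
    exact this
  have hid := Identity.sum_units_ratModP_ratPlusSymbol_mul_choose_eq f 1 hsq A hhecke hA hint ψ
    (by rw [hν]; exact hνp) r.primes.length (by rw [hν])
  rw [if_pos hν.symm] at hid
  have hsumint : ∀ a : (ZMod r.n)ˣ, ‖(((((∑ ℓ ∈ r.n.primeFactors.attach, Multiplicative.toAdd
        (ψ ℓ.1 (ZMod.unitsMap (Nat.dvd_of_mem_primeFactors ℓ.2) a))).val.choose r.primes.length : ℕ) : ℚ) *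
        ratPlusSymbol f ((((a : ZMod r.n).val : ℕ) : ℚ) / (r.n : ℚ)) : ℚ) : ℚ_[r.p])‖ ≤ 1 := fun a => by
    have := Summit.BirchSwinnertonDyer.BirchSwinnertonDyer.Theorems.deltaParity_norm_intCast_mul_le
      (((∑ ℓ ∈ r.n.primeFactors.attach, Multiplicative.toAdd
        (ψ ℓ.1 (ZMod.unitsMap (Nat.dvd_of_mem_primeFactors ℓ.2) a))).val.choose r.primes.length : ℕ) : ℤ)
      (hintn a)
    push_cast at this
    exact this
  have hS : ‖((∑ a : (ZMod r.n)ˣ, (((∑ ℓ ∈ r.n.primeFactors.attach, Multiplicative.toAdd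
        (ψ ℓ.1 (ZMod.unitsMap (Nat.dvd_of_mem_primeFactors ℓ.2) a))).val.choose r.primes.length : ℕ) : ℚ) *
        ratPlusSymbol f ((((a : ZMod r.n).val : ℕ) : ℚ) / (r.n : ℚ)) : ℚ) : ℚ_[r.p])‖ ≤ 1 :=
    Summit.BirchSwinnertonDyer.BirchSwinnertonDyer.Theorems.deltaParity_norm_sum_le _ fun a _ => hsumint a
  have hcS := Summit.BirchSwinnertonDyer.BirchSwinnertonDyer.Theorems.deltaParity_norm_intCast_mul_le
    (r.components : ℤ) hS
  have e1 : (r.den : ℚ) * (r.components : ℚ) *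
      ∑ a : (ZMod r.n)ˣ, (((∑ ℓ ∈ r.n.primeFactors.attach, Multiplicative.toAdd
        (ψ ℓ.1 (ZMod.unitsMap (Nat.dvd_of_mem_primeFactors ℓ.2) a))).val.choose r.primes.length : ℕ) : ℚ) *
        ratPlusSymbol f ((((a : ZMod r.n).val : ℕ) : ℚ) / (r.n : ℚ)) =
      ((r.den : ℤ) : ℚ) * (((r.components : ℤ) : ℚ) *
      ∑ a : (ZMod r.n)ˣ, (((∑ ℓ ∈ r.n.primeFactors.attach, Multiplicative.toAdd
        (ψ ℓ.1 (ZMod.unitsMap (Nat.dvd_of_mem_primeFactors ℓ.2) a))).val.choose r.primes.length : ℕ) : ℚ) *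
        ratPlusSymbol f ((((a : ZMod r.n).val : ℕ) : ℚ) / (r.n : ℚ))) := by
    push_cast; ring
  have hred : ratModP (r.p ^ 1) ((r.moment r.primes.length : ℤ) : ℚ) =
      ((r.den : ℤ) : ZMod (r.p ^ 1)) * (((r.components : ℤ) : ZMod (r.p ^ 1)) *
        kuriharaNumber f (r.p ^ 1) r.n ψ) := by
    rw [hmomQ, e1, deltaParity_ratModP_intCast_mul 1 (r.den : ℤ) hcS,
      deltaParity_ratModP_intCast_mul 1 (r.components : ℤ) hS,
      deltaParity_ratModP_sum 1 _ (fun a _ => hsumint a), ← hid]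
    congr 2
    refine Finset.sum_congr rfl fun a _ => ?_
    have e2 : ((((∑ ℓ ∈ r.n.primeFactors.attach, Multiplicative.toAdd
          (ψ ℓ.1 (ZMod.unitsMap (Nat.dvd_of_mem_primeFactors ℓ.2) a))).val.choose r.primes.length : ℕ) : ℚ))
        = ((((∑ ℓ ∈ r.n.primeFactors.attach, Multiplicative.toAdd
          (ψ ℓ.1 (ZMod.unitsMap (Nat.dvd_of_mem_primeFactors ℓ.2) a))).val.choose r.primes.length : ℕ) : ℤ) :
            ℚ) := by
      norm_cast
    rw [e2, deltaParity_ratModP_intCast_mul 1 _ (hintn a)]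
    push_cast
    ring
  -- (4) conclude: `\overline{e_ν} ≠ 0`
  intro hzero
  apply hM
  have h := hred
  rw [hzero, mul_zero, mul_zero, Literature.NumberTheory.EllipticCurves.ratModP_intCast,
    ZMod.intCast_zmod_eq_zero_iff_dvd] at h
  simpa [hp1] using h

end RecordOdd

section RecordOddNewform

variable {N : ℕ} [NeZero N] {f : CuspForm (Gamma0 N) 2}
  {W : WeierstrassCurve ℚ} [W.IsElliptic] [W.IsGloballyMinimal]

/-- **… for the newform of `E` at a Kolyvagin level** (`p` odd, `E[p]` irreducible, `r.n ∈ 𝒩_1(E, p)`): only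
the consumers' binders and `hbins`. [cite: Kim2022StructureSelmer, §1.4.3 (PDF p. 7)] -/
theorem TwistRecord.kuriharaNumber_ne_zero_of_consistentOdd_of_isNewformOf (r : TwistRecord)
    (hc : r.consistentOdd = true) (hδ : 0 < r.deltaModP) [hp : Fact r.p.Prime] [NeZero r.n]
    (hν : r.n.primeFactors.card = r.primes.length)
    (hf : IsNewformOf W f) (hp2 : r.p ≠ 2) (hirr : W.HasIrreducibleModPGaloisRep r.p)
    (hn : Kato.IsKolyvaginProduct W r.p 1 r.n)
    (ψ : (ℓ : ℕ) → (ZMod ℓ)ˣ →* Multiplicative (ZMod (r.p ^ 1)))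
    (hbins : ∀ j < r.p, ((r.bins.getD j 0 : ℤ) : ℚ) = (r.den : ℚ) * (r.components : ℚ) *
      ∑ a ∈ (Finset.univ : Finset (ZMod r.n)ˣ).filter (fun a =>
        (∑ ℓ ∈ r.n.primeFactors.attach, Multiplicative.toAdd
          (ψ ℓ.1 (ZMod.unitsMap (Nat.dvd_of_mem_primeFactors ℓ.2) a))).val = j),
        ratPlusSymbol f ((((a : ZMod r.n).val : ℕ) : ℚ) / (r.n : ℚ))) :
    kuriharaNumber f (r.p ^ 1) r.n ψ ≠ 0 := by
  have hgood : ∀ ℓ ∈ r.n.primeFactors, ∀ [Fact ℓ.Prime], W.HasGoodReductionAtPrime ℓ :=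
    fun ℓ hℓ _ => hasGoodReductionAtPrime_of_not_dvd_conductorNorm W
      (hn.isKolyvaginPrime (Nat.prime_of_mem_primeFactors hℓ)
        (Nat.dvd_of_mem_primeFactors hℓ)).not_dvd_conductorNorm
  have hcop : Nat.Coprime r.n N := Nat.coprime_of_dvd fun ℓ hℓp hℓn hℓN => by
    haveI : Fact ℓ.Prime := ⟨hℓp⟩
    have hmem : ℓ ∈ r.n.primeFactors := Nat.mem_primeFactors.mpr ⟨hℓp, hℓn, NeZero.ne r.n⟩
    exact not_dvd_level_of_isNewformOf hf (hgood ℓ hmem) hℓN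
  refine r.kuriharaNumber_ne_zero_of_consistentOdd f hc hδ hn.squarefree hν (fun ℓ => W.frobeniusTrace ℓ)
    (fun ℓ hℓ x => ?_)
    (fun ℓ hℓ => Identity.frobeniusTrace_cast_eq_two 1 (hn.isKolyvaginPrime (Nat.prime_of_mem_primeFactors hℓ)
      (Nat.dvd_of_mem_primeFactors hℓ)))
    (fun d hd z => hf.norm_ratPlusSymbol_div_le_one hp2 hirr (hcop.coprime_dvd_left hd) z) ψ hbins
  haveI : Fact ℓ.Prime := ⟨Nat.prime_of_mem_primeFactors hℓ⟩
  exact Identity.hecke_ratPlusSymbol_of_isNewformOf hf (hgood ℓ hℓ) x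

end RecordOddNewform

end Summit.BirchSwinnertonDyer.Rank1Residual.Supersingular.KuriharaTwist
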